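import Mathlib
import HarnessLib
import Summits.HubbardSuperconductivity.HubbardSuperconductivity.Theorems.KLProgrammeKLRegimeEngineV8E5BlockHybrid
import Summits.HubbardSuperconductivity.HubbardSuperconductivity.Theorems.KLProgrammeKLRegimeEngineV8E5BlockTrivial

/-!
# Route `KLProgramme` — ENGINE child gen 8 (stmt-HubbardSuperconductivity-20437 `KLRegimeEngineV17F2`), SKELETON v2 class #3, PROVING side:
# the HYBRID tails of THE E.5 block from LINE DATA and MIXED LEVEL NORMS, and the instance of record
# (cell gate-hubbard-kl, seat p5 g8; sequel to `…EngineV8E5BlockHybrid`; cure of FINDING (E5-VOL); hybrid twins of `…E5Block` §4 / `…E5BlockLabels` §2, §5)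

* §1 `klE5_hybridTail_le_of_lineData` (`m₀ + 1 ≥ 1` legs from copy `0`, pinned at one of them) / `…_of_b` (`m₁ + 1 ≥ 1` legs from copy `1`): hypothesis `hT`
  of `norm_klE5Block_le_of_hybridTails` at a colouring, from the symbols `sym s₀` of `Ċ_Λ` (row/column sums `≤ α` of the pulled-back line) and `sym s₁` of
  `C∞ − C_Λ` (entries `≤ δ`), Gram constants `κ`, the carrier's LEVEL NORMS at the value-form prescriptions (`Na k`: contracted legs free, outputs
  prescribed; `Nb k`: line-`0` leg + two explicit contracted sectors + outputs prescribed) for `k ∈ Icc 3 (|idx|+2)`, and ONE envelope;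
* §2 `klE5_hybridTail_le_of_lineData_pointAugment` / `…_of_b`: the same for the point-augmented pair from the OLD line data (w.r.t. `F̃`; symbols supported
  in the old plateau; overlap `ρ₀ + ρ₁ + 4`) and the MIXED level norms w.r.t. `pointAugment F e` — EXACTLY the `hNa/hNb` shapes of `…E5BlockLabels` §2;
* §3 **`norm_klE5Block_le_of_hybridTails_klAniso`** — the INSTANCE OF RECORD: `F = klAnisoFamily … K klE0 (m+1)`, `F̃ = bgmFatMultiplier … (m+1)`,
  `m + 2 ≤ n₀`, `0 < Λ ≤ Λ_{n₀}`; every family-side hypothesis discharged (multiplicity `9 + 4`), only the hybrid tails `hT` remain: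
  `‖klE5Block‖ ≤ 4!·|βL²|³·(‖(βL²)⁻¹‖⁴·(13⁴·(|SpaceTimeIdx|·Σ_s T s)))`; and **`norm_klE5Block_le_of_hybridTails_trivial`** — the first steps `n ≤ 2` through the
  ONE-sector family `trivialMultiplier` (plateau everywhere, multiplicity `1`; hybrid twin of `…E5BlockTrivial`, which has the same volume loss).

Pure composition; no definitions, no named facts, nothing about the model's sizes is asserted; nothing asserts superconductivity.
-/

noncomputable section

namespace Summit.HubbardSuperconductivity.HubbardSuperconductivity.Theorems.KLRegimeSplit

set_option linter.dupNamespace false -- summit = problem name (single-conjunct summit), D-0017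

open Real Finset Literature.MathematicalPhysics.QuantumLattice Literature.Probability.LatticeModels GrassmannAlgebra Matrix
open Literature.MathematicalPhysics.QuantumLattice.FermiRG
open Summit.HubbardSuperconductivity.HubbardSuperconductivity.Theorems.KLProgrammeLegKernels
open Summit.HubbardSuperconductivity.HubbardSuperconductivity.Theorems.KLRegimeWick
open Summit.HubbardSuperconductivity.HubbardSuperconductivity.Theorems.EngineV8
open Summit.HubbardSuperconductivity.HubbardSuperconductivity.Theorems.TwoPointAssembly
open Summit.HubbardSuperconductivity.HubbardSuperconductivity.Theorems.TorusFourierL2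

/-! ## §1 The HYBRID tails of the block from line data (generic pair) -/

section BlockTails

variable {L M N : ℕ} [NeZero L] (β μ : ℝ) (K : TrigPolyC4v) (n₀ : ℕ) (κ : FreqMomentum L M × Fin 2 → ℂ)
  (V : HubbardGrassmann L M) (Λ : ℝ) {ι : Type*} [Fintype ι] [DecidableEq ι]

/-- **The block's HYBRID tail at a colouring with `m₀ + 1 ≥ 1` legs from copy `0`**, pinned at such a leg `p` (`s p = 0`) at `z`, output labels `Ωo`.
[cite: BenfattoGiulianiMastropietro2006, §2.8 (2.80)] -/
theorem klE5_hybridTail_le_of_lineData {m₀ m₁ : ℕ} (hβ : 0 ≤ β) (F Ft : Fin N → FreqMomentum L M → ℂ)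
    {ρ₀ : ℕ} (hρ₀ : ∀ ω : Fin N, ((univ : Finset (Fin N)).filter fun ω' => ∃ q, Ft ω q * Ft ω' q ≠ 0).card ≤ ρ₀)
    (sym : ι → FreqMomentum L M × Fin 2 → ℂ) (s₀ s₁ : ι)
    (hs₀ : normalCovariance L M (sym s₀) = klE5DressedSliceDeriv L M β μ K n₀ κ Λ)
    (hs₁ : normalCovariance L M (sym s₁) = klE5Total L M β μ K n₀ κ - klE5DressedSlice L M β μ K n₀ κ Λ)
    (κg : ι → ℝ)
    (hκF : ∀ (t : ι) (Y : SpaceTimeIdx L M × SectorLeg N), Y.2.2 = 0 → ‖sectorGramF L M β Ft (sym t) Y‖ ≤ κg t)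
    (hκG : ∀ (t : ι) (Y : SpaceTimeIdx L M × SectorLeg N), Y.2.2 = 1 → ‖sectorGramG L M β Ft (sym t) Y‖ ≤ κg t)
    (s : Fin 4 → Fin 2) (hm₀ : (univ.filter fun i => s i = 0).card = m₀ + 1) (hm₁ : (univ.filter fun i => s i = 1).card = m₁)
    (p : Fin 4) (hp : s p = 0) (z : SpaceTimeIdx L M × SectorLeg N) (Ωo : Fin 4 → SectorLeg N) {α : ℝ} (hα : 0 ≤ α)
    (hrow : ∀ X, ∑ Y, ‖((sectorSubMatrix L M β Ft).transpose * normalCovariance L M (sym s₀) * sectorSubMatrix L M β Ft) X Y‖ ≤ α)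
    (hcol : ∀ Y, ∑ X, ‖((sectorSubMatrix L M β Ft).transpose * normalCovariance L M (sym s₀) * sectorSubMatrix L M β Ft) X Y‖ ≤ α)
    {δ : ℝ} (hδ : 0 ≤ δ) (hent : ∀ X Y, ‖((sectorSubMatrix L M β Ft).transpose * normalCovariance L M (sym s₁) * sectorSubMatrix L M β Ft) X Y‖ ≤ δ)
    (Na Nb : ℕ → ℝ) (hNb0 : ∀ k, 0 ≤ Nb k)
    (hNa : ∀ k ∈ Icc 3 (Fintype.card (HubbardFieldIdx L M × Fin 2) + 2), ∀ σ₀ : Fin (m₀ + 1) → SectorLeg N,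
      hubbardSectorKernelNorm L M β F (prescribedTuples univ
        (Fin.append (fun _ : Fin k => (none : Option (SectorLeg N))) (fun j => some (σ₀ j)))) (klE5Carrier L M β μ K n₀ κ V Λ) ≤ Na k)
    (hNb : ∀ k ∈ Icc 3 (Fintype.card (HubbardFieldIdx L M × Fin 2) + 2), ∀ (ω₀ : SectorLeg N) (τ' : Fin 2 → SectorLeg N) (ω₁ : Fin m₁ → SectorLeg N),
      hubbardSectorKernelNorm L M β F (prescribedTuples univ
        (Fin.append (fun i : Fin k => if h : (i : ℕ) < 3 then some ((Fin.cons ω₀ τ' : Fin 3 → SectorLeg N) ⟨i, h⟩) else none)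
          (fun j => some (ω₁ j)))) (klE5Carrier L M β μ K n₀ κ V Λ) ≤ Nb k)
    {x A : ℝ} (hx0 : 0 ≤ x) (hx1 : x < 1) (hA : 0 ≤ A)
    (henv : ∀ k ∈ Icc 3 (Fintype.card (HubbardFieldIdx L M × Fin 2) + 2),
      (∑ t, κg t ^ 2) ^ (k - 3) * ((imagTimeWeight β M * Na k) * (imagTimeWeight β M * Nb k)) ≤ x ^ (k - 3) * A) :
    ∑ i ∈ Finset.Icc 2 (Fintype.card (HubbardFieldIdx L M × Fin 2) + 1), ((i.factorial : ℝ))⁻¹ *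
      ∑ Z ∈ univ.filter (fun Z : Fin 4 → SpaceTimeIdx L M × SectorLeg N => Z p = z ∧ ∀ j, (Z j).2 = Ωo j),
        ‖kernel ℂ ((grassmannLaplacian ℂ (crossCov ℂ ((sectorSubMatrix L M β Ft).transpose *
              (klE5Total L M β μ K n₀ κ - klE5DressedSlice L M β μ K n₀ κ Λ) * sectorSubMatrix L M β Ft)) ^ i *
            grassmannLaplacian ℂ (crossCov ℂ ((sectorSubMatrix L M β Ft).transpose * klE5DressedSliceDeriv L M β μ K n₀ κ Λ *
              sectorSubMatrix L M β Ft)))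
          (dblCopy ℂ 0 (sectorPreimage β F (klE5Carrier L M β μ K n₀ κ V Λ)) *
            dblCopy ℂ 1 (sectorPreimage β F (klE5Carrier L M β μ K n₀ κ V Λ)))) 4 (fun j => (Z j, s j))‖ ≤
      ((m₀ + m₁ + 5).factorial : ℝ) / ((4 : ℕ).factorial * (1 - x) ^ (m₀ + m₁ + 6)) * (α * (δ * ((4 * ρ₀ : ℕ) : ℝ)) ^ 2 * A) := by
  have hsome : ∀ (ω₀ : SectorLeg N) (τ' : Fin 2 → SectorLeg N),
      (Fin.cons (some ω₀) (fun j => some (τ' j)) : Fin (2 + 1) → Option (SectorLeg N)) = fun i => some ((Fin.cons ω₀ τ' : Fin 3 → SectorLeg N) i) := by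
    intro ω₀ τ'
    funext i
    refine Fin.cases ?_ (fun j => ?_) i
    · rfl
    · simp only [Fin.cons_succ]
  have h := sum_norm_kernel_pow_mul_sectorPreimage_le_gramTailHybrid (e' := 2) (m := 4) (Nm := Fintype.card (HubbardFieldIdx L M × Fin 2) + 1) hβ F Ft
    hρ₀ sym s₀ s₁ κg hκF hκG (klE5Carrier L M β μ K n₀ κ V Λ) (klE5Carrier L M β μ K n₀ κ V Λ) s hm₀ hm₁ p hp z Ωo hα hrow hcol hδ hent Na Nb hNb0 hNa
    (fun k hk ω₀ τ' σ₁ => by rw [hsome]; exact hNb k hk ω₀ τ' σ₁) hx0 hx1 hA henv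
  rw [hs₀, hs₁] at h
  refine h.trans (le_of_eq ?_)
  have e1 : m₀ + 1 + m₁ + (2 + 1) + 1 = m₀ + m₁ + 5 := by ring
  have e2 : m₀ + 1 + m₁ + (2 + 1) + 2 = m₀ + m₁ + 6 := by ring
  rw [e1, e2]

/-- **The block's HYBRID tail at a colouring with `m₁ + 1 ≥ 1` legs from copy `1`**, pinned at such a leg `p` (`s p = 1`) (roles exchanged: `Na k` at
«line-`0` leg + explicit sectors + outputs prescribed», `Nb k` at «contracted legs free, outputs prescribed»). [cite: BenfattoGiulianiMastropietro2006, §2.8 (2.80)] -/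
theorem klE5_hybridTail_le_of_lineData_of_b {m₀ m₁ : ℕ} (hβ : 0 ≤ β) (F Ft : Fin N → FreqMomentum L M → ℂ)
    {ρ₀ : ℕ} (hρ₀ : ∀ ω : Fin N, ((univ : Finset (Fin N)).filter fun ω' => ∃ q, Ft ω q * Ft ω' q ≠ 0).card ≤ ρ₀)
    (sym : ι → FreqMomentum L M × Fin 2 → ℂ) (s₀ s₁ : ι)
    (hs₀ : normalCovariance L M (sym s₀) = klE5DressedSliceDeriv L M β μ K n₀ κ Λ)
    (hs₁ : normalCovariance L M (sym s₁) = klE5Total L M β μ K n₀ κ - klE5DressedSlice L M β μ K n₀ κ Λ)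
    (κg : ι → ℝ)
    (hκF : ∀ (t : ι) (Y : SpaceTimeIdx L M × SectorLeg N), Y.2.2 = 0 → ‖sectorGramF L M β Ft (sym t) Y‖ ≤ κg t)
    (hκG : ∀ (t : ι) (Y : SpaceTimeIdx L M × SectorLeg N), Y.2.2 = 1 → ‖sectorGramG L M β Ft (sym t) Y‖ ≤ κg t)
    (s : Fin 4 → Fin 2) (hm₀ : (univ.filter fun i => s i = 0).card = m₀) (hm₁ : (univ.filter fun i => s i = 1).card = m₁ + 1)
    (p : Fin 4) (hp : s p = 1) (z : SpaceTimeIdx L M × SectorLeg N) (Ωo : Fin 4 → SectorLeg N) {α : ℝ} (hα : 0 ≤ α)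
    (hrow : ∀ X, ∑ Y, ‖((sectorSubMatrix L M β Ft).transpose * normalCovariance L M (sym s₀) * sectorSubMatrix L M β Ft) X Y‖ ≤ α)
    (hcol : ∀ Y, ∑ X, ‖((sectorSubMatrix L M β Ft).transpose * normalCovariance L M (sym s₀) * sectorSubMatrix L M β Ft) X Y‖ ≤ α)
    {δ : ℝ} (hδ : 0 ≤ δ) (hent : ∀ X Y, ‖((sectorSubMatrix L M β Ft).transpose * normalCovariance L M (sym s₁) * sectorSubMatrix L M β Ft) X Y‖ ≤ δ)
    (Na Nb : ℕ → ℝ) (hNa0 : ∀ k, 0 ≤ Na k)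
    (hNa : ∀ k ∈ Icc 3 (Fintype.card (HubbardFieldIdx L M × Fin 2) + 2), ∀ (ω₀ : SectorLeg N) (σ' : Fin 2 → SectorLeg N) (ω₁ : Fin m₀ → SectorLeg N),
      hubbardSectorKernelNorm L M β F (prescribedTuples univ
        (Fin.append (fun i : Fin k => if h : (i : ℕ) < 3 then some ((Fin.cons ω₀ σ' : Fin 3 → SectorLeg N) ⟨i, h⟩) else none)
          (fun j => some (ω₁ j)))) (klE5Carrier L M β μ K n₀ κ V Λ) ≤ Na k)
    (hNb : ∀ k ∈ Icc 3 (Fintype.card (HubbardFieldIdx L M × Fin 2) + 2), ∀ σ₁ : Fin (m₁ + 1) → SectorLeg N,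
      hubbardSectorKernelNorm L M β F (prescribedTuples univ
        (Fin.append (fun _ : Fin k => (none : Option (SectorLeg N))) (fun j => some (σ₁ j)))) (klE5Carrier L M β μ K n₀ κ V Λ) ≤ Nb k)
    {x A : ℝ} (hx0 : 0 ≤ x) (hx1 : x < 1) (hA : 0 ≤ A)
    (henv : ∀ k ∈ Icc 3 (Fintype.card (HubbardFieldIdx L M × Fin 2) + 2),
      (∑ t, κg t ^ 2) ^ (k - 3) * ((imagTimeWeight β M * Na k) * (imagTimeWeight β M * Nb k)) ≤ x ^ (k - 3) * A) :
    ∑ i ∈ Finset.Icc 2 (Fintype.card (HubbardFieldIdx L M × Fin 2) + 1), ((i.factorial : ℝ))⁻¹ *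
      ∑ Z ∈ univ.filter (fun Z : Fin 4 → SpaceTimeIdx L M × SectorLeg N => Z p = z ∧ ∀ j, (Z j).2 = Ωo j),
        ‖kernel ℂ ((grassmannLaplacian ℂ (crossCov ℂ ((sectorSubMatrix L M β Ft).transpose *
              (klE5Total L M β μ K n₀ κ - klE5DressedSlice L M β μ K n₀ κ Λ) * sectorSubMatrix L M β Ft)) ^ i *
            grassmannLaplacian ℂ (crossCov ℂ ((sectorSubMatrix L M β Ft).transpose * klE5DressedSliceDeriv L M β μ K n₀ κ Λ *
              sectorSubMatrix L M β Ft)))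
          (dblCopy ℂ 0 (sectorPreimage β F (klE5Carrier L M β μ K n₀ κ V Λ)) *
            dblCopy ℂ 1 (sectorPreimage β F (klE5Carrier L M β μ K n₀ κ V Λ)))) 4 (fun j => (Z j, s j))‖ ≤
      ((m₀ + m₁ + 5).factorial : ℝ) / ((4 : ℕ).factorial * (1 - x) ^ (m₀ + m₁ + 6)) * (α * (δ * ((4 * ρ₀ : ℕ) : ℝ)) ^ 2 * A) := by
  have hsome : ∀ (ω₀ : SectorLeg N) (τ' : Fin 2 → SectorLeg N),
      (Fin.cons (some ω₀) (fun j => some (τ' j)) : Fin (2 + 1) → Option (SectorLeg N)) = fun i => some ((Fin.cons ω₀ τ' : Fin 3 → SectorLeg N) i) := by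
    intro ω₀ τ'
    funext i
    refine Fin.cases ?_ (fun j => ?_) i
    · rfl
    · simp only [Fin.cons_succ]
  have h := sum_norm_kernel_pow_mul_sectorPreimage_le_gramTailHybrid_of_b (e' := 2) (m := 4) (Nm := Fintype.card (HubbardFieldIdx L M × Fin 2) + 1) hβ
    F Ft hρ₀ sym s₀ s₁ κg hκF hκG (klE5Carrier L M β μ K n₀ κ V Λ) (klE5Carrier L M β μ K n₀ κ V Λ) s hm₀ hm₁ p hp z Ωo hα hrow hcol hδ hent Na Nb hNa0
    (fun k hk ω₀ σ' σ₀ => by rw [hsome]; exact hNa k hk ω₀ σ' σ₀) hNb hx0 hx1 hA henv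
  rw [hs₀, hs₁] at h
  refine h.trans (le_of_eq ?_)
  have e1 : m₀ + (m₁ + 1) + (2 + 1) + 1 = m₀ + m₁ + 5 := by ring
  have e2 : m₀ + (m₁ + 1) + (2 + 1) + 2 = m₀ + m₁ + 6 := by ring
  rw [e1, e2]

end BlockTails

/-! ## §2 The HYBRID tails of the point-augmented pair from the OLD line data and the MIXED level norms -/

section AugTails

variable {L M N : ℕ} [NeZero L] (β μ : ℝ) (K : TrigPolyC4v) (n₀ : ℕ) (κ : FreqMomentum L M × Fin 2 → ℂ)
  (V : HubbardGrassmann L M) (Λ : ℝ) (Qm : TorusSite 2 L) (x y : TorusSite 2 L × MatsubaraIdx M) {ι : Type*} [Fintype ι] [DecidableEq ι]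

/-- **Hypothesis `hT` of `norm_klE5Block_le_of_hybridTails_pointAugment` at a colouring with `m₀ + 1 ≥ 1` legs from copy `0`**, from the OLD line data
(`hrow/hcol/hent` and Gram `κg` w.r.t. `F̃`; every symbol supported in the plateau of `F`; overlap `ρ₀`, multiplicity `ρ₁`) and the carrier's MIXED
level norms w.r.t. the augmented thin family `F⁺ = pointAugment F e` (EXACTLY the prescriptions of `…E5BlockLabels` §2). [cite: BenfattoGiulianiMastropietro2006, §2.8 (2.80)] -/
theorem klE5_hybridTail_le_of_lineData_pointAugment {m₀ m₁ : ℕ} (hβ : 0 ≤ β) (F Ft : Fin N → FreqMomentum L M → ℂ)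
    {ρ₀ ρ₁ : ℕ} (hρ₀ : ∀ ω : Fin N, ((univ : Finset (Fin N)).filter fun ω' => ∃ q, Ft ω q * Ft ω' q ≠ 0).card ≤ ρ₀)
    (hρ₁ : ∀ k : FreqMomentum L M, ((univ : Finset (Fin N)).filter fun ω => Ft ω k ≠ 0).card ≤ ρ₁)
    (sym : ι → FreqMomentum L M × Fin 2 → ℂ) (s₀ s₁ : ι) (hsym : ∀ t ks, sym t ks ≠ 0 → ∑ ω, F ω ks.1 = 1)
    (hs₀ : normalCovariance L M (sym s₀) = klE5DressedSliceDeriv L M β μ K n₀ κ Λ)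
    (hs₁ : normalCovariance L M (sym s₁) = klE5Total L M β μ K n₀ κ - klE5DressedSlice L M β μ K n₀ κ Λ)
    (hĊ : ∀ X Y, klE5DressedSliceDeriv L M β μ K n₀ κ Λ X Y ≠ 0 → ∑ ω, F ω X.1.1 = 1 ∧ ∑ ω, F ω Y.1.1 = 1)
    (hD : ∀ X Y, (klE5Total L M β μ K n₀ κ - klE5DressedSlice L M β μ K n₀ κ Λ) X Y ≠ 0 → ∑ ω, F ω X.1.1 = 1 ∧ ∑ ω, F ω Y.1.1 = 1)
    (κg : ι → ℝ) (hκg : ∀ t, 0 ≤ κg t)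
    (hκF : ∀ (t : ι) (Y : SpaceTimeIdx L M × SectorLeg N), Y.2.2 = 0 → ‖sectorGramF L M β Ft (sym t) Y‖ ≤ κg t)
    (hκG : ∀ (t : ι) (Y : SpaceTimeIdx L M × SectorLeg N), Y.2.2 = 1 → ‖sectorGramG L M β Ft (sym t) Y‖ ≤ κg t)
    (s : Fin 4 → Fin 2) (hm₀ : (univ.filter fun i => s i = 0).card = m₀ + 1) (hm₁ : (univ.filter fun i => s i = 1).card = m₁)
    (p : Fin 4) (hp : s p = 0) (z : SpaceTimeIdx L M × SectorLeg (N + 4)) (Ωo : Fin 4 → SectorLeg (N + 4)) {α : ℝ} (hα : 0 ≤ α)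
    (hrow : ∀ X, ∑ Y, ‖((sectorSubMatrix L M β Ft).transpose * normalCovariance L M (sym s₀) * sectorSubMatrix L M β Ft) X Y‖ ≤ α)
    (hcol : ∀ Y, ∑ X, ‖((sectorSubMatrix L M β Ft).transpose * normalCovariance L M (sym s₀) * sectorSubMatrix L M β Ft) X Y‖ ≤ α)
    {δ : ℝ} (hδ : 0 ≤ δ) (hent : ∀ X Y, ‖((sectorSubMatrix L M β Ft).transpose * normalCovariance L M (sym s₁) * sectorSubMatrix L M β Ft) X Y‖ ≤ δ)
    (Na Nb : ℕ → ℝ) (hNb0 : ∀ k, 0 ≤ Nb k)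
    (hNa : ∀ k ∈ Icc 3 (Fintype.card (HubbardFieldIdx L M × Fin 2) + 2), ∀ σ₀ : Fin (m₀ + 1) → SectorLeg (N + 4),
      hubbardSectorKernelNorm L M β (pointAugment F (klE5ExtMomenta Qm x y)) (prescribedTuples univ
        (Fin.append (fun _ : Fin k => (none : Option (SectorLeg (N + 4)))) (fun j => some (σ₀ j)))) (klE5Carrier L M β μ K n₀ κ V Λ) ≤ Na k)
    (hNb : ∀ k ∈ Icc 3 (Fintype.card (HubbardFieldIdx L M × Fin 2) + 2), ∀ (ω₀ : SectorLeg (N + 4)) (τ' : Fin 2 → SectorLeg (N + 4))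
      (ω₁ : Fin m₁ → SectorLeg (N + 4)),
      hubbardSectorKernelNorm L M β (pointAugment F (klE5ExtMomenta Qm x y)) (prescribedTuples univ
        (Fin.append (fun i : Fin k => if h : (i : ℕ) < 3 then some ((Fin.cons ω₀ τ' : Fin 3 → SectorLeg (N + 4)) ⟨i, h⟩) else none)
          (fun j => some (ω₁ j)))) (klE5Carrier L M β μ K n₀ κ V Λ) ≤ Nb k)
    {x' A : ℝ} (hx0 : 0 ≤ x') (hx1 : x' < 1) (hA : 0 ≤ A)
    (henv : ∀ k ∈ Icc 3 (Fintype.card (HubbardFieldIdx L M × Fin 2) + 2),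
      (∑ t, κg t ^ 2) ^ (k - 3) * ((imagTimeWeight β M * Na k) * (imagTimeWeight β M * Nb k)) ≤ x' ^ (k - 3) * A) :
    ∑ i ∈ Finset.Icc 2 (Fintype.card (HubbardFieldIdx L M × Fin 2) + 1), ((i.factorial : ℝ))⁻¹ *
      ∑ Z ∈ univ.filter (fun Z : Fin 4 → SpaceTimeIdx L M × SectorLeg (N + 4) => Z p = z ∧ ∀ j, (Z j).2 = Ωo j),
        ‖kernel ℂ ((grassmannLaplacian ℂ (crossCov ℂ ((sectorSubMatrix L M β (pointAugmentFat F Ft (klE5ExtMomenta Qm x y))).transpose *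
              (klE5Total L M β μ K n₀ κ - klE5DressedSlice L M β μ K n₀ κ Λ) * sectorSubMatrix L M β (pointAugmentFat F Ft (klE5ExtMomenta Qm x y)))) ^ i *
            grassmannLaplacian ℂ (crossCov ℂ ((sectorSubMatrix L M β (pointAugmentFat F Ft (klE5ExtMomenta Qm x y))).transpose *
              klE5DressedSliceDeriv L M β μ K n₀ κ Λ * sectorSubMatrix L M β (pointAugmentFat F Ft (klE5ExtMomenta Qm x y)))))
          (dblCopy ℂ 0 (sectorPreimage β (pointAugment F (klE5ExtMomenta Qm x y)) (klE5Carrier L M β μ K n₀ κ V Λ)) *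
            dblCopy ℂ 1 (sectorPreimage β (pointAugment F (klE5ExtMomenta Qm x y)) (klE5Carrier L M β μ K n₀ κ V Λ)))) 4 (fun j => (Z j, s j))‖ ≤
      ((m₀ + m₁ + 5).factorial : ℝ) / ((4 : ℕ).factorial * (1 - x') ^ (m₀ + m₁ + 6)) * (α * (δ * ((4 * (ρ₀ + ρ₁ + 4) : ℕ) : ℝ)) ^ 2 * A) := by
  have hĊ' : ∀ X Y, normalCovariance L M (sym s₀) X Y ≠ 0 → ∑ ω, F ω X.1.1 = 1 ∧ ∑ ω, F ω Y.1.1 = 1 := by rw [hs₀]; exact hĊ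
  have hD' : ∀ X Y, normalCovariance L M (sym s₁) X Y ≠ 0 → ∑ ω, F ω X.1.1 = 1 ∧ ∑ ω, F ω Y.1.1 = 1 := by rw [hs₁]; exact hD
  exact klE5_hybridTail_le_of_lineData β μ K n₀ κ V Λ hβ (pointAugment F (klE5ExtMomenta Qm x y)) (pointAugmentFat F Ft (klE5ExtMomenta Qm x y))
    (card_filter_overlap_pointAugmentFat_le F Ft _ hρ₀ hρ₁) sym s₀ s₁ hs₀ hs₁ κg
    (fun t Y hY => norm_sectorGramF_pointAugmentFat_le β F Ft _ (sym t) (hsym t) (hκg t) (hκF t) Y hY)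
    (fun t Y hY => norm_sectorGramG_pointAugmentFat_le β F Ft _ (sym t) (hsym t) (hκg t) (hκG t) Y hY)
    s hm₀ hm₁ p hp z Ωo hα
    (rowSum_pullback_pointAugmentFat_le β F Ft _ _ hĊ' hα hrow) (colSum_pullback_pointAugmentFat_le β F Ft _ _ hĊ' hα hcol)
    hδ (entry_pullback_pointAugmentFat_le β F Ft _ _ hD' hδ hent) Na Nb hNb0 hNa hNb hx0 hx1 hA henv

/-- **The same at a colouring with `m₁ + 1 ≥ 1` legs from copy `1`** (pinned there; roles of the level norms exchanged). [cite: BenfattoGiulianiMastropietro2006, §2.8 (2.80)] -/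
theorem klE5_hybridTail_le_of_lineData_pointAugment_of_b {m₀ m₁ : ℕ} (hβ : 0 ≤ β) (F Ft : Fin N → FreqMomentum L M → ℂ)
    {ρ₀ ρ₁ : ℕ} (hρ₀ : ∀ ω : Fin N, ((univ : Finset (Fin N)).filter fun ω' => ∃ q, Ft ω q * Ft ω' q ≠ 0).card ≤ ρ₀)
    (hρ₁ : ∀ k : FreqMomentum L M, ((univ : Finset (Fin N)).filter fun ω => Ft ω k ≠ 0).card ≤ ρ₁)
    (sym : ι → FreqMomentum L M × Fin 2 → ℂ) (s₀ s₁ : ι) (hsym : ∀ t ks, sym t ks ≠ 0 → ∑ ω, F ω ks.1 = 1)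
    (hs₀ : normalCovariance L M (sym s₀) = klE5DressedSliceDeriv L M β μ K n₀ κ Λ)
    (hs₁ : normalCovariance L M (sym s₁) = klE5Total L M β μ K n₀ κ - klE5DressedSlice L M β μ K n₀ κ Λ)
    (hĊ : ∀ X Y, klE5DressedSliceDeriv L M β μ K n₀ κ Λ X Y ≠ 0 → ∑ ω, F ω X.1.1 = 1 ∧ ∑ ω, F ω Y.1.1 = 1)
    (hD : ∀ X Y, (klE5Total L M β μ K n₀ κ - klE5DressedSlice L M β μ K n₀ κ Λ) X Y ≠ 0 → ∑ ω, F ω X.1.1 = 1 ∧ ∑ ω, F ω Y.1.1 = 1)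
    (κg : ι → ℝ) (hκg : ∀ t, 0 ≤ κg t)
    (hκF : ∀ (t : ι) (Y : SpaceTimeIdx L M × SectorLeg N), Y.2.2 = 0 → ‖sectorGramF L M β Ft (sym t) Y‖ ≤ κg t)
    (hκG : ∀ (t : ι) (Y : SpaceTimeIdx L M × SectorLeg N), Y.2.2 = 1 → ‖sectorGramG L M β Ft (sym t) Y‖ ≤ κg t)
    (s : Fin 4 → Fin 2) (hm₀ : (univ.filter fun i => s i = 0).card = m₀) (hm₁ : (univ.filter fun i => s i = 1).card = m₁ + 1)
    (p : Fin 4) (hp : s p = 1) (z : SpaceTimeIdx L M × SectorLeg (N + 4)) (Ωo : Fin 4 → SectorLeg (N + 4)) {α : ℝ} (hα : 0 ≤ α)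
    (hrow : ∀ X, ∑ Y, ‖((sectorSubMatrix L M β Ft).transpose * normalCovariance L M (sym s₀) * sectorSubMatrix L M β Ft) X Y‖ ≤ α)
    (hcol : ∀ Y, ∑ X, ‖((sectorSubMatrix L M β Ft).transpose * normalCovariance L M (sym s₀) * sectorSubMatrix L M β Ft) X Y‖ ≤ α)
    {δ : ℝ} (hδ : 0 ≤ δ) (hent : ∀ X Y, ‖((sectorSubMatrix L M β Ft).transpose * normalCovariance L M (sym s₁) * sectorSubMatrix L M β Ft) X Y‖ ≤ δ)
    (Na Nb : ℕ → ℝ) (hNa0 : ∀ k, 0 ≤ Na k)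
    (hNa : ∀ k ∈ Icc 3 (Fintype.card (HubbardFieldIdx L M × Fin 2) + 2), ∀ (ω₀ : SectorLeg (N + 4)) (σ' : Fin 2 → SectorLeg (N + 4))
      (ω₁ : Fin m₀ → SectorLeg (N + 4)),
      hubbardSectorKernelNorm L M β (pointAugment F (klE5ExtMomenta Qm x y)) (prescribedTuples univ
        (Fin.append (fun i : Fin k => if h : (i : ℕ) < 3 then some ((Fin.cons ω₀ σ' : Fin 3 → SectorLeg (N + 4)) ⟨i, h⟩) else none)
          (fun j => some (ω₁ j)))) (klE5Carrier L M β μ K n₀ κ V Λ) ≤ Na k)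
    (hNb : ∀ k ∈ Icc 3 (Fintype.card (HubbardFieldIdx L M × Fin 2) + 2), ∀ σ₁ : Fin (m₁ + 1) → SectorLeg (N + 4),
      hubbardSectorKernelNorm L M β (pointAugment F (klE5ExtMomenta Qm x y)) (prescribedTuples univ
        (Fin.append (fun _ : Fin k => (none : Option (SectorLeg (N + 4)))) (fun j => some (σ₁ j)))) (klE5Carrier L M β μ K n₀ κ V Λ) ≤ Nb k)
    {x' A : ℝ} (hx0 : 0 ≤ x') (hx1 : x' < 1) (hA : 0 ≤ A)
    (henv : ∀ k ∈ Icc 3 (Fintype.card (HubbardFieldIdx L M × Fin 2) + 2),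
      (∑ t, κg t ^ 2) ^ (k - 3) * ((imagTimeWeight β M * Na k) * (imagTimeWeight β M * Nb k)) ≤ x' ^ (k - 3) * A) :
    ∑ i ∈ Finset.Icc 2 (Fintype.card (HubbardFieldIdx L M × Fin 2) + 1), ((i.factorial : ℝ))⁻¹ *
      ∑ Z ∈ univ.filter (fun Z : Fin 4 → SpaceTimeIdx L M × SectorLeg (N + 4) => Z p = z ∧ ∀ j, (Z j).2 = Ωo j),
        ‖kernel ℂ ((grassmannLaplacian ℂ (crossCov ℂ ((sectorSubMatrix L M β (pointAugmentFat F Ft (klE5ExtMomenta Qm x y))).transpose *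
              (klE5Total L M β μ K n₀ κ - klE5DressedSlice L M β μ K n₀ κ Λ) * sectorSubMatrix L M β (pointAugmentFat F Ft (klE5ExtMomenta Qm x y)))) ^ i *
            grassmannLaplacian ℂ (crossCov ℂ ((sectorSubMatrix L M β (pointAugmentFat F Ft (klE5ExtMomenta Qm x y))).transpose *
              klE5DressedSliceDeriv L M β μ K n₀ κ Λ * sectorSubMatrix L M β (pointAugmentFat F Ft (klE5ExtMomenta Qm x y)))))
          (dblCopy ℂ 0 (sectorPreimage β (pointAugment F (klE5ExtMomenta Qm x y)) (klE5Carrier L M β μ K n₀ κ V Λ)) *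
            dblCopy ℂ 1 (sectorPreimage β (pointAugment F (klE5ExtMomenta Qm x y)) (klE5Carrier L M β μ K n₀ κ V Λ)))) 4 (fun j => (Z j, s j))‖ ≤
      ((m₀ + m₁ + 5).factorial : ℝ) / ((4 : ℕ).factorial * (1 - x') ^ (m₀ + m₁ + 6)) * (α * (δ * ((4 * (ρ₀ + ρ₁ + 4) : ℕ) : ℝ)) ^ 2 * A) := by
  have hĊ' : ∀ X Y, normalCovariance L M (sym s₀) X Y ≠ 0 → ∑ ω, F ω X.1.1 = 1 ∧ ∑ ω, F ω Y.1.1 = 1 := by rw [hs₀]; exact hĊ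
  have hD' : ∀ X Y, normalCovariance L M (sym s₁) X Y ≠ 0 → ∑ ω, F ω X.1.1 = 1 ∧ ∑ ω, F ω Y.1.1 = 1 := by rw [hs₁]; exact hD
  exact klE5_hybridTail_le_of_lineData_of_b β μ K n₀ κ V Λ hβ (pointAugment F (klE5ExtMomenta Qm x y)) (pointAugmentFat F Ft (klE5ExtMomenta Qm x y))
    (card_filter_overlap_pointAugmentFat_le F Ft _ hρ₀ hρ₁) sym s₀ s₁ hs₀ hs₁ κg
    (fun t Y hY => norm_sectorGramF_pointAugmentFat_le β F Ft _ (sym t) (hsym t) (hκg t) (hκF t) Y hY)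
    (fun t Y hY => norm_sectorGramG_pointAugmentFat_le β F Ft _ (sym t) (hsym t) (hκg t) (hκG t) Y hY)
    s hm₀ hm₁ p hp z Ωo hα
    (rowSum_pullback_pointAugmentFat_le β F Ft _ _ hĊ' hα hrow) (colSum_pullback_pointAugmentFat_le β F Ft _ _ hĊ' hα hcol)
    hδ (entry_pullback_pointAugmentFat_le β F Ft _ _ hD' hδ hent) Na Nb hNa0 hNa hNb hx0 hx1 hA henv

end AugTails

/-! ## §3 The instance of record: `F = klAnisoFamily … K klE0 (m+1)`, `F̃ = bgmFatMultiplier … (m+1)`, `m + 2 ≤ n₀` -/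

section KlAniso

variable {L M : ℕ} [NeZero L] [NeZero M] (β μ : ℝ) (K : TrigPolyC4v) (n₀ : ℕ) (κ : FreqMomentum L M × Fin 2 → ℂ)
  (V : HubbardGrassmann L M) (Λ : ℝ) (Qm : TorusSite 2 L) (x y : TorusSite 2 L × MatsubaraIdx M)

/-- **The E.5 block at ANY labels for the thin/fat pair of record, HYBRID form** (`klAnisoFamily … K klE0 (m+1)` / `bgmFatMultiplier … (m+1)`,
`m + 2 ≤ n₀`, `0 < Λ ≤ Λ_{n₀}`): every family-side hypothesis of `norm_klE5Block_le_of_hybridTails_pointAugment` is discharged (`F̃F = F`, `ΣF = 0 ⇒ F = 0`,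
`‖F̃‖ ≤ 1`, multiplicity `9` from overlap `9`, the plateaux of the two lines); what remains is the colouring-wise HYBRID tail hypothesis `hT` (from
`klE5_hybridTail_le_of_lineData_pointAugment(_of_b)` with `ρ₀ = ρ₁ = 9`). Net prefactor `4!·13⁴·|βL²|³·‖(βL²)⁻¹‖⁴·|SpaceTimeIdx| = 4!·13⁴·(2M/β)` against tails
of order `ε = β/(2M)` — (L, M)-uniform. [cite: BenfattoGiulianiMastropietro2006, §2.7 (2.70)] -/
theorem norm_klE5Block_le_of_hybridTails_klAniso (hβ : β ≠ 0) {m : ℕ} (hm : m + 2 ≤ n₀) (hΛ0 : 0 < Λ) (hΛ : Λ ≤ klScale klE0 n₀)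
    (p : (Fin 4 → Fin 2) → Fin 4) (T : (Fin 4 → Fin 2) → ℝ) (hT0 : ∀ s, 0 ≤ T s)
    (hT : ∀ (s : Fin 4 → Fin 2) (σ : Fin 4 → SectorLeg (sectorCount (m + 1) + 4)) (xp : SpaceTimeIdx L M),
      ∑ i ∈ Finset.Icc 2 (Fintype.card (HubbardFieldIdx L M × Fin 2) + 1), ((i.factorial : ℝ))⁻¹ *
        ∑ Z ∈ univ.filter (fun Z : Fin 4 → SpaceTimeIdx L M × SectorLeg (sectorCount (m + 1) + 4) => Z (p s) = (xp, σ (p s)) ∧ ∀ j, (Z j).2 = σ j),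
        ‖kernel ℂ ((grassmannLaplacian ℂ (crossCov ℂ
              ((sectorSubMatrix L M β (pointAugmentFat (klAnisoFamily L M β μ K klE0 (m + 1))
                  (bgmFatMultiplier L M klE0 β (nambuXiCT L μ K) (m + 1)) (klE5ExtMomenta Qm x y))).transpose *
                (klE5Total L M β μ K n₀ κ - klE5DressedSlice L M β μ K n₀ κ Λ) *
                sectorSubMatrix L M β (pointAugmentFat (klAnisoFamily L M β μ K klE0 (m + 1))
                  (bgmFatMultiplier L M klE0 β (nambuXiCT L μ K) (m + 1)) (klE5ExtMomenta Qm x y)))) ^ i *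
            grassmannLaplacian ℂ (crossCov ℂ
              ((sectorSubMatrix L M β (pointAugmentFat (klAnisoFamily L M β μ K klE0 (m + 1))
                  (bgmFatMultiplier L M klE0 β (nambuXiCT L μ K) (m + 1)) (klE5ExtMomenta Qm x y))).transpose *
                klE5DressedSliceDeriv L M β μ K n₀ κ Λ *
                sectorSubMatrix L M β (pointAugmentFat (klAnisoFamily L M β μ K klE0 (m + 1))
                  (bgmFatMultiplier L M klE0 β (nambuXiCT L μ K) (m + 1)) (klE5ExtMomenta Qm x y)))))
          (dblCopy ℂ 0 (sectorPreimage β (pointAugment (klAnisoFamily L M β μ K klE0 (m + 1)) (klE5ExtMomenta Qm x y))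
              (klE5Carrier L M β μ K n₀ κ V Λ)) *
            dblCopy ℂ 1 (sectorPreimage β (pointAugment (klAnisoFamily L M β μ K klE0 (m + 1)) (klE5ExtMomenta Qm x y))
              (klE5Carrier L M β μ K n₀ κ V Λ)))) 4 (fun j => (Z j, s j))‖ ≤ T s) :
    ‖klE5Block L M β μ K n₀ κ V Λ Qm x y‖ ≤ ((4 : ℕ).factorial : ℝ) * |β * (L : ℝ) ^ 2| ^ 3 *
      (‖((1 / (β * (L : ℝ) ^ 2) : ℝ) : ℂ)‖ ^ 4 * (((9 + 4 : ℕ) : ℝ) ^ 4 * (Fintype.card (SpaceTimeIdx L M) * ∑ s : Fin 4 → Fin 2, T s))) := by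
  have hm' : (m + 1) + 1 ≤ n₀ := by omega
  have hρ₀ := card_overlap_bgmFat_le_nine (L := L) (M := M) (e₀ := klE0) (β := β) (μ := μ) (K := K) m
  refine norm_klE5Block_le_of_hybridTails_pointAugment β μ K n₀ κ V Λ Qm x y hβ (klAnisoFamily L M β μ K klE0 (m + 1))
    (bgmFatMultiplier L M klE0 β (nambuXiCT L μ K) (m + 1)) (fun ω k => ?_) (klAnisoFamily_eq_zero_of_sum_eq_zero β μ K klE0 (m + 1))
    (norm_bgmFatMultiplier_le_one klE0 β (nambuXiCT L μ K) (m + 1)) (card_filter_ne_zero_le_of_overlap _ fun ω => by convert hρ₀ ω)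
    (klE5DressedSliceDeriv_plateau_klAnisoFamily β μ K n₀ κ hm' hΛ0 hΛ) (klE5Total_sub_dressedSlice_plateau_klAnisoFamily β μ K n₀ κ hm' hΛ0 hΛ)
    p T hT0 hT
  unfold klAnisoFamily
  exact bgmFatMultiplier_mul_bgmMultiplier (by norm_num [klE0]) β (nambuXiCT L μ K) (m + 1) ω k

end KlAniso

/-! ## §4 The first steps `n ≤ 2`: the trivial sectorisation, HYBRID form -/

section Trivial

variable {L M : ℕ} [NeZero L] [NeZero M] (β μ : ℝ) (K : TrigPolyC4v) (n₀ : ℕ) (κ : FreqMomentum L M × Fin 2 → ℂ)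
  (V : HubbardGrassmann L M) (Λ : ℝ) (Qm : TorusSite 2 L) (x y : TorusSite 2 L × MatsubaraIdx M)

/-- **The E.5 block through the TRIVIAL sectorisation, HYBRID form** (`F = F̃ = trivialMultiplier`, plateau everywhere, multiplicity `1`): at ANY labels,
`‖klE5Block … κ V Λ Qm x y‖ ≤ 4!·|βL²|³·(‖(βL²)⁻¹‖⁴·(1⁴·(|SpaceTimeIdx|·Σ_s T s)))` from the colouring-wise HYBRID tails of the UNSECTORISED two-vertex terms
(`hT` = `klE5_hybridTail_le_of_lineData(_of_b)` at `F = F̃ = trivialMultiplier`, `ρ₀ = 1`, level norms = plain `L¹–L^∞` kernel norms with prescribed labels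
trivial). [cite: BenfattoGiulianiMastropietro2006, §2.7 (2.70)] -/
theorem norm_klE5Block_le_of_hybridTails_trivial (hβ : β ≠ 0) (p : (Fin 4 → Fin 2) → Fin 4) (T : (Fin 4 → Fin 2) → ℝ) (hT0 : ∀ s, 0 ≤ T s)
    (hT : ∀ (s : Fin 4 → Fin 2) (σ : Fin 4 → SectorLeg 1) (xp : SpaceTimeIdx L M),
      ∑ i ∈ Finset.Icc 2 (Fintype.card (HubbardFieldIdx L M × Fin 2) + 1), ((i.factorial : ℝ))⁻¹ *
        ∑ Z ∈ univ.filter (fun Z : Fin 4 → SpaceTimeIdx L M × SectorLeg 1 => Z (p s) = (xp, σ (p s)) ∧ ∀ j, (Z j).2 = σ j),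
        ‖kernel ℂ ((grassmannLaplacian ℂ (crossCov ℂ ((sectorSubMatrix L M β (trivialMultiplier L M)).transpose *
              (klE5Total L M β μ K n₀ κ - klE5DressedSlice L M β μ K n₀ κ Λ) * sectorSubMatrix L M β (trivialMultiplier L M))) ^ i *
            grassmannLaplacian ℂ (crossCov ℂ ((sectorSubMatrix L M β (trivialMultiplier L M)).transpose * klE5DressedSliceDeriv L M β μ K n₀ κ Λ *
              sectorSubMatrix L M β (trivialMultiplier L M))))
          (dblCopy ℂ 0 (sectorPreimage β (trivialMultiplier L M) (klE5Carrier L M β μ K n₀ κ V Λ)) *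
            dblCopy ℂ 1 (sectorPreimage β (trivialMultiplier L M) (klE5Carrier L M β μ K n₀ κ V Λ)))) 4 (fun j => (Z j, s j))‖ ≤ T s) :
    ‖klE5Block L M β μ K n₀ κ V Λ Qm x y‖ ≤ ((4 : ℕ).factorial : ℝ) * |β * (L : ℝ) ^ 2| ^ 3 *
      (‖((1 / (β * (L : ℝ) ^ 2) : ℝ) : ℂ)‖ ^ 4 * (((1 : ℕ) : ℝ) ^ 4 * (Fintype.card (SpaceTimeIdx L M) * ∑ s : Fin 4 → Fin 2, T s))) :=
  norm_klE5Block_le_of_hybridTails β μ K n₀ κ V Λ Qm x y hβ (trivialMultiplier L M) (trivialMultiplier L M) trivialMultiplier_mul_self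
    trivialMultiplier_eq_zero_of_sum_eq_zero norm_trivialMultiplier_le_one card_filter_trivialMultiplier_ne_zero_le
    (fun _ _ _ => ⟨sum_trivialMultiplier _, sum_trivialMultiplier _⟩) (fun _ _ _ => ⟨sum_trivialMultiplier _, sum_trivialMultiplier _⟩)
    (sum_trivialMultiplier _) (sum_trivialMultiplier _) (sum_trivialMultiplier _) (sum_trivialMultiplier _) p T hT0 hT

end Trivial

/-! ## §5 The prefactor in units of the time weight: `4!·|βL²|³·‖(βL²)⁻¹‖⁴·ρ⁴·|SpaceTimeIdx| = 4!·ρ⁴·ε⁻¹` (volume-free) -/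

section Prefactor

variable {L M : ℕ} [NeZero L] [NeZero M]

/-- **The hybrid prefactor is `4!·ρ⁴/ε`**, `ε = imagTimeWeight β M = β/(2M)` (`ε·|SpaceTimeIdx L M| = βL²`): no power of the volume survives — against the
hybrid tails' `ε·α = O(1)` (row sum × weight) and `A = ε²·Na·Nb`-type envelopes the E.5 bound is (L, M)-uniform (FINDING (E5-VOL) cured). [folklore] -/
theorem klE5_hybridPrefactor_eq {β : ℝ} (hβ : 0 < β) (ρ S : ℝ) :
    ((4 : ℕ).factorial : ℝ) * |β * (L : ℝ) ^ 2| ^ 3 * (‖((1 / (β * (L : ℝ) ^ 2) : ℝ) : ℂ)‖ ^ 4 * (ρ ^ 4 * (Fintype.card (SpaceTimeIdx L M) * S))) =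
      ((4 : ℕ).factorial : ℝ) * ρ ^ 4 * (imagTimeWeight β M)⁻¹ * S := by
  have hL : (0 : ℝ) < (L : ℝ) := by exact_mod_cast Nat.pos_of_ne_zero (NeZero.ne L)
  have hV : 0 < β * (L : ℝ) ^ 2 := by positivity
  have hcard : (Fintype.card (SpaceTimeIdx L M) : ℝ) = β * (L : ℝ) ^ 2 / imagTimeWeight β M := by
    have h := imagTimeWeight_mul_card β L M
    have hε : imagTimeWeight β M ≠ 0 := by
      intro h0
      rw [h0, zero_mul] at h
      exact hV.ne h
    field_simp
    linarith [h]
  rw [Complex.norm_real, Real.norm_of_nonneg (by positivity), abs_of_pos hV, hcard]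
  have hε : imagTimeWeight β M ≠ 0 := by
    have := imagTimeWeight_mul_card β L M
    intro h0; rw [h0, zero_mul] at this; exact hV.ne this
  field_simp

end Prefactor

end Summit.HubbardSuperconductivity.HubbardSuperconductivity.Theorems.KLRegimeSplit

end
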